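import Summits.QuantumFields.YangMills.Theorems.BalabanUVNodesN11Thm2Ineq249AtRecord13CoPHOfSect3Sentences
import Summits.QuantumFields.YangMills.Theorems.BalabanUVNodesN11Thm2CubeCountAtRecord13CoPH

/-!
# DAG node N11 — (2.49) FOR THE EFFECTIVE ACTION OF RECORD FROM [III]'s §3 ANALYSIS, THE VACUUM SENTENCE AND THE β-WINDOW LETTERS ONLY: the capstone
# `…OfSect3Sentences` with BOTH p. 263 counts DISCHARGED (`…Thm2PointCountAtRecord13CoPH`, `…Thm2CubeCountAtRecord13CoPH`) at the print volumes `|Γ_n(s)|` and `L := F.L`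

Cell `pub-ymgap`, YM-PLAN Track A (HUMAN RULING D-0062 ∕ D-0149), seat `pub-ymgap-dag-n11-w2` (g0), route `BalabanUVNodes`, key item K1⁷ `StabilityBAtRecordR13SepCoPH` =
stmt-QuantumFields-20542 (helper, count-neutral).  [III] = [Balaban1988Convergent].

WHAT THIS FILE PROVES (0 `sorry`, 0 `def`, standard axioms; count-neutral; nothing of Bałaban's asserted — the §3 sentences, the vacuum sentence and the window letters are HYPOTHESES).
★★ `ineq249_action23_at_record₁₃CoPH_constCoupling_of_phi_eq_one` — the ALL-SMALL two-sided form at the record (dag-n13-w3's `h249low`∕`h249up` socket, asked on the bus l.25656):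
where `φ_j ≡ 1` (j ≤ k), Theorem 2's sentences + (2.48) + (2.46)'s inputs + vacuum ⇒ BOTH halves of (2.49) with the CONSTANT coupling `(1∕g_k²)·A(U)`.
★★★ `ineq249_action23_at_record₁₃CoPH_of_sect3Analysis`: for a run `p`, a history `s` of length `k ≤ K`, an exposed §2 witness `t`, `a`, `E_k = EkLog + EkRest`, `U`: FROM (𝐄) per scale a point
support `Z_j ⊂ Ω_j(s)`-points (`hZΩ`) with the partition (3.65), and (3.67) per point STATED SCALE-FREE («for z ∈ Λ_j⁰∩(Ω_n∖Ω_{n+1}) the bracket is O((LʲL⁻ⁿ)^{5−β})»: for whichever `n ∈ [j,k]`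
has `z ∈ Γ_n(s)`; the scale map is chosen inside via `exists_scale_of_mem_Omega`); (𝐑) per scale a
chosen cube `pick_j X ∈ X` with scale `scR_j` and the cube INSIDE `Γ_{scR}(s)` (`hscR`), p. 283's per-domain bound, `κ ≥ κ₀(4·2⁴, 8)`; (𝐁) class map + (2.47) per class with `0 ≤ V_n ≤ |Γ_n(s)|`;
the vacuum sentence; the window letters; `1 ≤ θ.τ9.M` — TO `Ineq249 (action23 …) (A(1∕g_k²(·),U)) (−EkLog) (cE(1−F.L^{−(1−b)})⁻¹ + 1 + 2B₁ + E₂) (n ↦ |Γ_n(s)|) k`, where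
`|Γ_n(s)| = #{y ∈ T₁^{(n)} : y ∈ gammaRegion s.Ω k n}` (p. 263 «the number of points in Γ_n ⊂ T₁^{(n)}»).  The p. 263 counts are no longer hypotheses.

HONEST FRAMING.  What stays hypothesis is exactly [III] §3's analytic content at the objects of record + the vacuum sentence + the DAG's unprinted β lower bound + print's «g sufficiently
small»; the junction to N13's Cor.-3 binder `h249` stays N13's ∕ def-T's.  N11 NOT discharged; K1⁷ NOT closed; counts unmoved (typed 28∕28 · discharged 5∕27).  One finite four-torus
programme at fixed `ε = L^{−K}`; R4 closes only the conditional finite-𝕋⁴ rung `BalabanLadder.UV`; NOT ℝ⁴, NOT OS, NOT a mass gap, NOT Clay.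
Sources: [III] (2.43)–(2.49) pp. 263–264, (3.65)–(3.67) p. 283, p. 283, (2.1)–(2.2) pp. 254–255; [II] (1.26) p. 8; [I] (0.20) p. 256, (0.1) p. 251.
-/

noncomputable section

open scoped BigOperators Matrix.Norms.L2Operator

namespace Summit.QuantumFields.YangMills.Theorems.BalabanUVNodesN11Thm2Ineq249AtRecord13CoPHOfSect3Analysis

open Literature.MathematicalPhysics.QuantumFieldTheory.Balaban1983to89 Step B12TreeDecay TreeLengthTorus B14.Eq225Concrete B14.LocalCoupling B14Thm2 Finset
open T4Continuum
open Node00 hiding blockIter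
open FlowStepRuns (genFlow)
open B15DeterminingSets (gammaRegion)
open B10Eq38TorusDomains (toFine)
open B14.Eq213MaximalDomains (side)
open BalabanUVNodesN11Thm2Ineq249AtRecord13CoPHOfSect3Sentences (ineq249_action23_at_record₁₃CoPH_of_sect3Sentences)
open BalabanUVNodesN11Thm2PointCountAtRecord13CoPH (hcount_at_record₁₃ exists_scale_of_mem_Omega)
open BalabanUVNodesN11Thm2CubeCountAtRecord13CoPH (hcountR_at_record₁₃)

variable {F : T4Family} {N : ℕ} [NeZero N]
variable (θ : Stage13HParams F N) (p : B12.RunParams) {k : ℕ}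

open Classical in
/-- **★★★ (2.49) FOR THE (2.23)-ACTION OF RECORD FROM [III]'s §3 ANALYSIS + THE VACUUM SENTENCE + THE WINDOW LETTERS, p. 263 COUNTS DISCHARGED** (volumes `|Γ_n(s)|`, block size `F.L`).
[cite: Balaban1988Convergent, (2.43)–(2.49) pp.263–264, (3.65)–(3.67) p.283, p.283, (2.1)–(2.2) pp.254–255; Balaban1988RG2Cluster, (1.26) p.8; Balaban1987RG1, (0.20) p.256] -/
theorem ineq249_action23_at_record₁₃CoPH_of_sect3Analysis (s : SeqOfRecord F θ.ν θ.τ9.M (gOfRecord₁₃ F N θ.toStage13Params p) p.K k) (hkK : k ≤ p.K)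
    (hM : 1 ≤ θ.τ9.M) (t : Sect2.TermValues (F.P p.K) (MatA N) (FluctV N) θ.τ9.M) (a : Tk.SFluct (F.P p.K) (FluctV N)) (κ₀ : ℕ) (hκ : 7 ≤ κ₀)
    (Ek EkLog EkRest : ℝ) (hEk : Ek = EkLog + EkRest) (U : GaugeField (F.P p.K) 0 (SU N)) (cE cR B₁ b E₂ : ℝ)
    (hb : b < 1) (hcE : 0 ≤ cE) (hcR : 0 ≤ cR) (hB : 0 ≤ B₁)
    {γ b' : ℝ} {K' : ℕ} (hb' : 0 < b') (hγ4 : γ ^ 4 ≤ b') (hγ2 : γ ≤ 1 / 2)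
    (hRγ : (cR * K₀ (4 * 2 ^ (F.P p.K).d) (2 * (F.P p.K).d)) * γ ^ (κ₀ - 6) ≤ 1)
    (hI : (genFlow (betaOfRecord₁₃ F N θ.toStage13Params) p.g0).InInterval γ K')
    (hlb : ∀ j, j < K' → b' ≤ 1 / gOfRecord₁₃ F N θ.toStage13Params p j ^ 2 - 1 / gOfRecord₁₃ F N θ.toStage13Params p (j + 1) ^ 2) (hk : k ≤ K')
    -- (𝐄)
    (Z : (j : ℕ) → Finset (Site (F.P p.K) j)) (h : (j : ℕ) → Site (F.P p.K) j → Plaq (F.P p.K) 0 → ℝ)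
    (hφ : ∀ j, 1 ≤ j → j ≤ k → ∀ q, θ.Phih p k s.Ω s.Λ j q = ∑ z ∈ Z j, h j z q)
    (hZ : ∀ j, 1 ≤ j → j ≤ k → ∀ z, z ∉ Z j → ∀ X, Sect2.admE (F.P p.K) θ.ν θ.τ9.M (gOfRecord₁₃ F N θ.toStage13Params p) s.Λ j (Sect2.domSites (F.P p.K) θ.τ9.M j X) z = false)
    (hZΩ : ∀ j, 1 ≤ j → j ≤ k → ∀ z ∈ Z j, toFine j z ∈ s.Ω j)
    (h367 : ∀ j, 1 ≤ j → j ≤ k → ∀ z ∈ Z j, ∀ n, j ≤ n → n ≤ k → toFine j z ∈ gammaRegion s.Ω k n →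
      |(∑ X : (Sect2.domSys (F.P p.K) θ.τ9.M j).Dom,
        (if Sect2.admE (F.P p.K) θ.ν θ.τ9.M (gOfRecord₁₃ F N θ.toStage13Params p) s.Λ j (Sect2.domSites (F.P p.K) θ.τ9.M j X) z then
          ((t.E j X z (gOfRecord₁₃ F N θ.toStage13Params p (j - 1)) (Sect2.ofBackgroundC (ιSU N) U)).re -
            (t.E j X z (gOfRecord₁₃ F N θ.toStage13Params p (j - 1)) (Sect2.ofBackgroundC (ιSU N) 1)).re) else 0))
        - (1 / gOfRecord₁₃ F N θ.toStage13Params p (j - 1) ^ 2 - 1 / gOfRecord₁₃ F N θ.toStage13Params p j ^ 2) * smearedWilson (h j z) U| ≤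
        cE * (((F.P p.K).L : ℝ) ^ ((j : ℝ) - n)) ^ (5 - b))
    -- (𝐑)
    {κ : ℝ} (hκR : kappa₀ (4 * 2 ^ (F.P p.K).d) (2 * (F.P p.K).d) ≤ κ)
    (pick : (j : ℕ) → (Sect2.domSys (F.P p.K) θ.τ9.M j).Dom → TPt (F.P p.K).d (Sect2.domCount (F.P p.K) θ.τ9.M j))
    (hpick : ∀ j, 1 ≤ j → j ≤ k → ∀ X, Sect2.admR (F.P p.K) θ.ν θ.τ9.M (gOfRecord₁₃ F N θ.toStage13Params p) s.Λ j (Sect2.domSites (F.P p.K) θ.τ9.M j X) = true → pick j X ∈ X.1)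
    (scR : (j : ℕ) → TPt (F.P p.K).d (Sect2.domCount (F.P p.K) θ.τ9.M j) → ℕ)
    (hscR : ∀ j, 1 ≤ j → j ≤ k → ∀ X, Sect2.admR (F.P p.K) θ.ν θ.τ9.M (gOfRecord₁₃ F N θ.toStage13Params p) s.Λ j (Sect2.domSites (F.P p.K) θ.τ9.M j X) = true →
      (j ≤ scR j (pick j X) ∧ scR j (pick j X) ≤ k) ∧
        cubeEnl (F.P p.K) (side (F.P p.K).L θ.τ9.M j) (Sect2.liftIdx (F.P p.K) (pick j X)) 0 ⊆ gammaRegion s.Ω k (scR j (pick j X)))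
    (hr : ∀ j, 1 ≤ j → j ≤ k → ∀ X, Sect2.admR (F.P p.K) θ.ν θ.τ9.M (gOfRecord₁₃ F N θ.toStage13Params p) s.Λ j (Sect2.domSites (F.P p.K) θ.τ9.M j X) = true →
      |(t.R j X (Sect2.ofBackgroundC (ιSU N) U)).re - (t.R j X (Sect2.ofBackgroundC (ιSU N) 1)).re| ≤
        cR * (((F.P p.K).L : ℝ) ^ ((j : ℝ) - scR j (pick j X))) ^ 4 * (gOfRecord₁₃ F N θ.toStage13Params p j) ^ κ₀ * Real.exp (-κ * (Sect2.domSys (F.P p.K) θ.τ9.M j).dj X))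
    -- (𝐁)
    (cls : (j : ℕ) → (Sect2.domSys (F.P p.K) θ.τ9.M j).Dom → ℕ)
    (hcls : ∀ j, 1 ≤ j → j ≤ k → ∀ X, Sect2.admB (F.P p.K) θ.ν θ.τ9.M (gOfRecord₁₃ F N θ.toStage13Params p) s.Ω s.Λ j (Sect2.domSites (F.P p.K) θ.τ9.M j X) = true →
      1 ≤ cls j X ∧ cls j X ≤ j)
    (V : ℕ → ℝ) (hV : ∀ n, 1 ≤ n → n ≤ k → 0 ≤ V n)
    (hVΓ : ∀ n, 1 ≤ n → n ≤ k → V n ≤ ((univ.filter fun y : Site (F.P p.K) n => toFine n y ∈ gammaRegion s.Ω k n).card : ℝ))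
    (h247 : ∀ n j, 1 ≤ n → n ≤ j → j ≤ k →
      |∑ X : (Sect2.domSys (F.P p.K) θ.τ9.M j).Dom,
          (if Sect2.admB (F.P p.K) θ.ν θ.τ9.M (gOfRecord₁₃ F N θ.toStage13Params p) s.Ω s.Λ j (Sect2.domSites (F.P p.K) θ.τ9.M j X) = true ∧ cls j X = n then
            (t.B j X (Sect2.ofBackgroundC (ιSU N) U) a).re else 0)| ≤ B₁ * (2 : ℝ) ^ (-((j : ℝ) - n)) * V n)
    -- vacuum
    (hvac : VacuumRestBound EkRest E₂ (fun n => ((univ.filter fun y : Site (F.P p.K) n => toFine n y ∈ gammaRegion s.Ω k n).card : ℝ)) k) :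
    Ineq249 ((sect2ActionDataOfRecord F N (FluctV N) p.K (settingOfRecord₁₃ F N θ.toStage13Params p) (θ.rzAt p s) s t a Ek).action23 k U)
      (smearedWilson (invSq (flowOfRun (gOfRecord₁₃ F N θ.toStage13Params p)) (θ.Phih p k s.Ω s.Λ) k) U) (-EkLog)
      (cE * (1 - ((F.P p.K).L : ℝ) ^ (-(1 - b)))⁻¹ + 1 + 2 * B₁ + E₂)
      (fun n => ((univ.filter fun y : Site (F.P p.K) n => toFine n y ∈ gammaRegion s.Ω k n).card : ℝ)) k := by
  have hL : (1 : ℝ) < ((F.P p.K).L : ℝ) := by exact_mod_cast (F.P p.K).hL.2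
  have hkmK : k ≤ (F.P p.K).m + (F.P p.K).K := by rw [T4Family.P_K]; omega
  -- the canonical scale of a point of `Ω_j(s)`: the `n ∈ [j,k]` with the point in `Γ_n(s)` (choice over `exists_scale_of_mem_Omega`)
  have hsc : ∀ j, 1 ≤ j → j ≤ k → ∃ sc : Site (F.P p.K) j → ℕ, ∀ z ∈ Z j, (j ≤ sc z ∧ sc z ≤ k) ∧ toFine j z ∈ gammaRegion s.Ω k (sc z) := by
    intro j hj hjk
    refine ⟨fun z => if hz : z ∈ Z j then Classical.choose (exists_scale_of_mem_Omega θ p s hj hjk (hZΩ j hj hjk z hz)) else j, fun z hz => ?_⟩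
    simp only [dif_pos hz]
    obtain ⟨h1, h2, h3⟩ := Classical.choose_spec (exists_scale_of_mem_Omega θ p s hj hjk (hZΩ j hj hjk z hz))
    exact ⟨⟨h1, h2⟩, h3⟩
  choose! scE hscE using hsc
  refine ineq249_action23_at_record₁₃CoPH_of_sect3Sentences θ p s t a κ₀ hκ Ek EkLog EkRest hEk U cE cR B₁ ((F.P p.K).L : ℝ) b E₂ _ hL hb hcE hcR hB
    (fun _ _ _ => Nat.cast_nonneg _) hb' hγ4 hγ2 hRγ hI hlb hk Z h hφ hZ scE (fun j hj hjk z hz => (hscE j hj hjk z hz).1)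
    (fun j hj hjk z hz => h367 j hj hjk z hz (scE j z) (hscE j hj hjk z hz).1.1 (hscE j hj hjk z hz).1.2 (hscE j hj hjk z hz).2)
    (fun j hj hjk n => ?_) hκR pick hpick scR (fun j hj hjk X hX => (hscR j hj hjk X hX).1) hr (fun j hj hjk n => ?_) cls hcls V hV hVΓ h247 hvac
  · -- the 𝐄-side count at scale n: points of Z j of scale n lie in Γ_n(s)
    by_cases hn : j ≤ n ∧ n ≤ k
    · exact hcount_at_record₁₃ θ p s hj hn.1 (hn.2.trans hkmK) (Z j) (scE j) fun z hz hzn => by rw [← hzn]; exact (hscE j hj hjk z hz).2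
    · have h0 : ((Z j).filter fun z => scE j z = n) = ∅ := by
        refine Finset.filter_false_of_mem fun z hz hzn => hn ?_
        rw [← hzn]; exact (hscE j hj hjk z hz).1
      rw [h0, Finset.card_empty, Nat.cast_zero]
      exact mul_nonneg (Real.rpow_nonneg (Real.rpow_nonneg (by positivity) _) _) (Nat.cast_nonneg _)
  · -- the 𝐑-side count at scale n: chosen cubes of scale n lie inside Γ_n(s)
    by_cases hn : j ≤ n ∧ n ≤ k
    · refine hcountR_at_record₁₃ θ p s hj hn.1 (hn.2.trans hkmK) hM _ (scR j) fun x hx hxn => ?_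
      obtain ⟨X, hX, rfl⟩ := Finset.mem_image.mp hx
      have hX' := (Finset.mem_filter.mp hX).2
      rw [← hxn]; exact (hscR j hj hjk X hX').2
    · have h0 : (((univ.filter fun X => Sect2.admR (F.P p.K) θ.ν θ.τ9.M (gOfRecord₁₃ F N θ.toStage13Params p) s.Λ j
          (Sect2.domSites (F.P p.K) θ.τ9.M j X) = true).image (pick j)).filter fun z => scR j z = n) = ∅ := by
        refine Finset.filter_false_of_mem fun x hx hxn => hn ?_
        obtain ⟨X, hX, rfl⟩ := Finset.mem_image.mp hx
        rw [← hxn]; exact (hscR j hj hjk X (Finset.mem_filter.mp hX).2).1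
      rw [h0, Finset.card_empty, Nat.cast_zero]
      exact mul_nonneg (Real.rpow_nonneg (Real.rpow_nonneg (by positivity) _) _) (Nat.cast_nonneg _)

/-- **★★ THE ALL-SMALL TWO-SIDED FORM AT THE RECORD** (the socket `h249low`∕`h249up` of dag-n13-w3's `…N13Cor3AsymJunctionAtRecord13CoPH` in r11's (2.23) letter): where every cut-off of
the history is one (`φ_j ≡ 1`, j ≤ k — the all-small-field history, p. 259 «g_j²(x) = g_j² on the last domain»), Theorem 2's sentences at the record's summands + (2.48) + (2.46)'s
inputs + the vacuum sentence give BOTH halves of (2.49) WITH THE CONSTANT COUPLING: `Ineq249 (action23 …) ((1∕g_k²)·A(U)) (−EkLog) (E₁(1−L^{−β})⁻¹ + 1 + 2B₁ + E₂) Γ k`, `g_k = gOfRecord₁₃ … p k`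
(file 1's `ineq249_action23_concrete_constCoupling_of_phi_eq_one` at `settingOfRecord₁₃`∕`θ.rzAt p s`; (0.20) by `flowOfRun_satisfiesRG`). [cite: Balaban1988Convergent, (2.49)–(2.50) p.264, (2.24) p.259, Thm 2 p.263] -/
theorem ineq249_action23_at_record₁₃CoPH_constCoupling_of_phi_eq_one (s : SeqOfRecord F θ.ν θ.τ9.M (gOfRecord₁₃ F N θ.toStage13Params p) p.K k)
    (t : Sect2.TermValues (F.P p.K) (MatA N) (FluctV N) θ.τ9.M) (a : Tk.SFluct (F.P p.K) (FluctV N)) (κ₀ : ℕ) (hκ : 7 ≤ κ₀)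
    (Ek EkLog EkRest : ℝ) (hEk : Ek = EkLog + EkRest) (U : GaugeField (F.P p.K) 0 (SU N)) (E₁ R₁ B₁ L β E₂ : ℝ) (Γ : ℕ → ℝ)
    (hL : 1 < L) (hβ : 0 < β) (hE : 0 ≤ E₁) (hR : 0 ≤ R₁) (hΓ : ∀ n, 1 ≤ n → n ≤ k → 0 ≤ Γ n)
    (hφ1 : ∀ j, 1 ≤ j → j ≤ k → ∀ x, θ.Phih p k s.Ω s.Λ j x = 1)
    (h243 : ∀ j, 1 ≤ j → j ≤ k →
      |EjSub (sect2TowerOfRecord F N (FluctV N) p.K (settingOfRecord₁₃ F N θ.toStage13Params p) (θ.rzAt p s) s t)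
            (fun j X z => Sect2.admE (F.P p.K) θ.ν θ.τ9.M (gOfRecord₁₃ F N θ.toStage13Params p) s.Λ j (Sect2.domSites (F.P p.K) θ.τ9.M j X) z) j U
          - (1 / gOfRecord₁₃ F N θ.toStage13Params p (j - 1) ^ 2 - 1 / gOfRecord₁₃ F N θ.toStage13Params p j ^ 2) *
              smearedWilson (θ.Phih p k s.Ω s.Λ j) U| ≤ E₁ * ∑ n ∈ Icc j k, (L ^ ((j : ℝ) - n)) ^ β * Γ n)
    (h244 : ∀ j, 1 ≤ j → j ≤ k →
      |∑ X : (Sect2.domSys (F.P p.K) θ.τ9.M j).Dom, (if Sect2.admR (F.P p.K) θ.ν θ.τ9.M (gOfRecord₁₃ F N θ.toStage13Params p) s.Λ j (Sect2.domSites (F.P p.K) θ.τ9.M j X) then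
          ((t.R j X (Sect2.ofBackgroundC (ιSU N) U)).re - (t.R j X (Sect2.ofBackgroundC (ιSU N) 1)).re) else 0)| ≤
        R₁ * (gOfRecord₁₃ F N θ.toStage13Params p j) ^ κ₀ * ∑ n ∈ Icc j k, Γ n)
    (hsum : ∀ n, 1 ≤ n → n ≤ k → ∑ j ∈ Icc 1 n, (gOfRecord₁₃ F N θ.toStage13Params p j) ^ κ₀ ≤ (gOfRecord₁₃ F N θ.toStage13Params p n) ^ (κ₀ - 6))
    (hsmall : ∀ n, 1 ≤ n → n ≤ k → R₁ * (gOfRecord₁₃ F N θ.toStage13Params p n) ^ (κ₀ - 6) ≤ 1)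
    (h248 : |B240 (sect2TowerOfRecord F N (FluctV N) p.K (settingOfRecord₁₃ F N θ.toStage13Params p) (θ.rzAt p s) s t)
        (fun j X => Sect2.admB (F.P p.K) θ.ν θ.τ9.M (gOfRecord₁₃ F N θ.toStage13Params p) s.Ω s.Λ j (Sect2.domSites (F.P p.K) θ.τ9.M j X)) a k U| ≤
      2 * B₁ * ∑ n ∈ Icc 1 k, Γ n)
    (hvac : VacuumRestBound EkRest E₂ Γ k) :
    Ineq249 ((sect2ActionDataOfRecord F N (FluctV N) p.K (settingOfRecord₁₃ F N θ.toStage13Params p) (θ.rzAt p s) s t a Ek).action23 k U)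
      (1 / (gOfRecord₁₃ F N θ.toStage13Params p k) ^ 2 * wilsonAction4 U) (-EkLog) (E₁ * (1 - L ^ (-β))⁻¹ + 1 + 2 * B₁ + E₂) Γ k :=
  BalabanUVNodesN11Thm2Ineq249AtRecord13CoPH.ineq249_action23_concrete_constCoupling_of_phi_eq_one
    (sect2TowerOfRecord F N (FluctV N) p.K (settingOfRecord₁₃ F N θ.toStage13Params p) (θ.rzAt p s) s t) _ _ _ (θ.Phih p k s.Ω s.Λ) k κ₀ hκ a Ek EkLog EkRest hEk U
    E₁ R₁ B₁ L β E₂ Γ hL hβ hE hR hΓ (flowOfRun_satisfiesRG (gOfRecord₁₃ F N θ.toStage13Params p) k) le_rfl hφ1 h243 h244 hsum hsmall h248 hvac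

end Summit.QuantumFields.YangMills.Theorems.BalabanUVNodesN11Thm2Ineq249AtRecord13CoPHOfSect3Analysis

end
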